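import Summits.Ventures.PackingBounds.Energy.FivePointRieszSevenGramDataA2
import Summits.Ventures.PackingBounds.Energy.FivePointRieszSevenGramDataB1
import Summits.Ventures.PackingBounds.Energy.FivePointRieszSevenGramDataB2
import Summits.Ventures.PackingBounds.Energy.GramDataCheck
import HarnessLib

/-!
# The rational part of the 77 × 77 Gram block of `e3pt-sharp-n3N5s7d6K-none.json` is positive semidefinite (kernel-checked on integer data)

Framing: lottery ticket; floor = certified bounds/negative ranges. Venture `PackingBounds`, cell
`pub-packcert`, energy family E3PT (pub-packcert-energy gen 12 generator `e3pt_lean_d6.py`, run by gen 17 from `code/e3pt/g17/kroute/`; KERNEL-D6 data route).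

`decide +kernel` checks, in row chunks, the integer identity `S·Mp = L Lᵀ + E` with `E` symmetric (`GramData.checkRows`) (the diagonal dominance of `E`, `GramData.checkDD`, is evaluated in `FivePointRieszSevenBridge`) for the data modules `FivePointRieszSevenGramDataA1/A2/B1/B2`; the row chunks are assembled in `FivePointRieszSevenBridge`, where `GramData.psd_of_checks` then gives
`Σ_{i,j<77} (S·Mp)_{ij} y_i y_j ≥ 0` for every real `y` (applied in `FivePointRieszSevenBridge`). No polynomial identity is expanded.
-/

namespace Summit.Ventures.PackingBounds.Energy.RieszSevenD6

open Summit.Ventures.PackingBounds.Energy.GramData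

set_option maxRecDepth 100000 in
/-- Rows 0–9 of `S·Mp = L Lᵀ + E`, `E` symmetric (kernel evaluation). -/
theorem rowsQ_0_10 : checkRows 77 77 0 10 yQ lQ eQ = true := by decide +kernel

set_option maxRecDepth 100000 in
/-- Rows 10–19 of `S·Mp = L Lᵀ + E`, `E` symmetric (kernel evaluation). -/
theorem rowsQ_10_20 : checkRows 77 77 10 20 yQ lQ eQ = true := by decide +kernel

set_option maxRecDepth 100000 in
/-- Rows 20–29 of `S·Mp = L Lᵀ + E`, `E` symmetric (kernel evaluation). -/
theorem rowsQ_20_30 : checkRows 77 77 20 30 yQ lQ eQ = true := by decide +kernel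

set_option maxRecDepth 100000 in
/-- Rows 30–39 of `S·Mp = L Lᵀ + E`, `E` symmetric (kernel evaluation). -/
theorem rowsQ_30_40 : checkRows 77 77 30 40 yQ lQ eQ = true := by decide +kernel

set_option maxRecDepth 100000 in
/-- Rows 40–49 of `S·Mp = L Lᵀ + E`, `E` symmetric (kernel evaluation). -/
theorem rowsQ_40_50 : checkRows 77 77 40 50 yQ lQ eQ = true := by decide +kernel

set_option maxRecDepth 100000 in
/-- Rows 50–59 of `S·Mp = L Lᵀ + E`, `E` symmetric (kernel evaluation). -/
theorem rowsQ_50_60 : checkRows 77 77 50 60 yQ lQ eQ = true := by decide +kernel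

set_option maxRecDepth 100000 in
/-- Rows 60–69 of `S·Mp = L Lᵀ + E`, `E` symmetric (kernel evaluation). -/
theorem rowsQ_60_70 : checkRows 77 77 60 70 yQ lQ eQ = true := by decide +kernel

set_option maxRecDepth 100000 in
/-- Rows 70–76 of `S·Mp = L Lᵀ + E`, `E` symmetric (kernel evaluation). -/
theorem rowsQ_70_77 : checkRows 77 77 70 77 yQ lQ eQ = true := by decide +kernel


end Summit.Ventures.PackingBounds.Energy.RieszSevenD6
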